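import Summits.ResolutionOfSingularities.ResolutionOfSingularities.Theorems.RadicialJungCleanModelsReadOffCriticalExponents
import Summits.ResolutionOfSingularities.ResolutionOfSingularities.Theorems.RadicialJungCleanModelsGiraudLogJacobianStructure
import Summits.ResolutionOfSingularities.ResolutionOfSingularities.Theorems.RadicialJungCleanModelsGiraudLogJacobianPBasis
import Summits.ResolutionOfSingularities.ResolutionOfSingularities.Theorems.ValuativeLuAlphaPTorsorGcdBookkeeping
import Literature.AlgebraicGeometry.Resolution.RegularLocalRingsUFD
import HarnessLib

/-!
# [OURS · L W8.1 · T2 brick B7, PARTS (2)+(6)] `c = 0` at a critical point makes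
# `J(O, f, E(f))` a principal MONOMIAL ideal `(xᵃyᵇ)` (resp. `(xᵃ)`), and the read-off of
# Giraud's normal form from «critical primes = the branches, `c = 0`, `f ∉ Oᵖ`» at ring level

Programme `PROGRAMME-clean-dim2` / T2 (res-L0-w81-pv-2 g5), spec `HOME/L/res-L0-w81-pv-2/g5/B7-SPEC.md`
§(2) and §(6); crux stmt-ResolutionOfSingularities-15917 (`T2Skeleton.lean` v2, stub
`stub_readOff_critical`); `--supports … --as helper`. OURS; AI-written, weaker than expert review;
nothing here is a statement of H. Hironaka's manuscript.

* § 1 (crossing twin of `…GiraudLogJacobianStructure` § 4) — in a noetherian factorial domain, if the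
  critical primes of `f` are exactly `(x)` and `(y)` (`x, y` prime elements), every prime element
  dividing all of `J = J(O, f, E(f))` is associated to `x` or to `y` (`xy·D` is logarithmic along both
  branches, so `π ∣ xy·D f` for all `D`; a third prime `π` would give `J(O, f) ⊆ (π)`, a third
  critical prime): `associated_or_associated_of_prime_of_logDerivJacobianIdeal_le_span`; hence
  (with the tree's `PfaffLine.exists_associated_pow_mul_pow_of_forall_prime_dvd`)
  `B(J) = (xᵃyᵇ)` and `J = (xᵃyᵇ)·D(J)`:
  `exists_principalHullIdeal_logDerivJacobianIdeal_eq_span_pow_mul_pow`.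
* § 2 **`c = 0` ⇒ `J` principal monomial**: `D(J) = ⊤` (`giraudColength_eq_zero_iff`), so
  `J = (xᵃ)` at a non-crossing point (`logDerivJacobianIdeal_eq_span_pow_of_giraudColength_eq_zero`)
  and `J = (xᵃyᵇ)` at a crossing point (`…_eq_span_pow_mul_pow_…`). [Giraud 1983, 2.2: given (*),
  `c = 0` iff `J(X, f, E(f))` is invertible.]
* § 3 the log-Jacobian ideal in the span form of the realiser files when the critical primes are the
  branches: `logDerivJacobianIdeal_eq_span_logDerivation₁/₂`.
* § 4 **`giraud15NormalFormAt_of_criticalPrimes_eq₂` / `…_eq₁`** — for a two-dimensional regular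
  local `𝔽_p`-algebra `O`, formally smooth over `𝔽_p`, regular parameters `x, y` in a `p`-basis `Γ`
  of `O` over `O^p`: «`derivCriticalPrimes O f = {(x), (y)}` (resp. `{(x)}`), `f ∉ O^p`,
  `giraudColength O f = 0`» ⇒ `Giraud15NormalFormAt p f`. Composition of § 2–§ 3 with
  `giraud15NormalFormAt_{crossing,noncrossing}_of_critical` (`…ReadOffCriticalExponents`, PARTS
  (3)+(4)+(5)); `J ≠ 0` from `f ∉ O^p` by `logDerivJacobianIdeal_ne_bot`; factoriality by
  Auslander–Buchsbaum (`uniqueFactorizationMonoid_of_isRegularLocalRing`).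

What remains of `stub_readOff_critical` after this file: scheme-to-stalk plumbing, spec part (1)
«`IsStrictNormalCrossingsAt X (derivCriticalSet X f) ξ` ⇒ regular parameters `(x, y)` of `𝒪_{X,ξ}`
with `derivCriticalPrimes 𝒪_{X,ξ} f_ξ = {(x), (y)}` or `{(x)}`», the adapted `p`-basis
(res-L0-w81-pv-2's `exists_isPBasisOver_containing_rsop`) and `hf ⇒ f_ξ ∉ 𝒪_{X,ξ}^p`.

References: J. Giraud, Bull. SMF 111 (1983), 2.1, 2.2, 2.5 and Prop. 1.5 [Giraud1983]; H. Matsumura,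
*Commutative Ring Theory*, Thm. 20.3 [Matsumura1987].
-/

noncomputable section

set_option linter.dupNamespace false -- mandated namespace of this single-conjunct summit

open IsLocalRing
open Literature.RingTheory.PBasis Literature.AlgebraicGeometry.Resolution

namespace Summit.ResolutionOfSingularities.ResolutionOfSingularities.Theorems.RadicialJung.CleanModels

universe u

/-! ## § 1 At a crossing point: the common prime divisors of `J(O, f, E(f))` are `∼ x` or `∼ y` -/

section Crossing

variable {O : Type u} [CommRing O] [IsDomain O]

omit [IsDomain O] in
/-- `x·y` lies in every critical prime when these are exactly `(x)` and `(y)`. [folklore] -/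
theorem mul_mem_of_mem_derivCriticalPrimes₂ {x y : O} (f : O)
    (hcrit : ∀ P : Ideal O, P ∈ derivCriticalPrimes O f ↔ (P = Ideal.span {x} ∨ P = Ideal.span {y}))
    (P : Ideal O) (hP : P ∈ derivCriticalPrimes O f) : x * y ∈ P := by
  rcases (hcrit P).mp hP with h | h
  · rw [h]; exact Ideal.mul_mem_right _ _ (Ideal.mem_span_singleton_self x)
  · rw [h]; exact Ideal.mul_mem_left _ _ (Ideal.mem_span_singleton_self y)

/-- A prime element dividing a prime element `x` is associated to it. [folklore] -/
theorem associated_of_prime_dvd_prime {π x : O} (hπ : Prime π) (hx : Prime x) (h : π ∣ x) :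
    Associated π x := by
  obtain ⟨w, hw⟩ := h
  rcases hx.irreducible.isUnit_or_isUnit hw with hu | hu
  · exact absurd hu hπ.not_unit
  · exact ⟨hu.unit, by rw [IsUnit.unit_spec, hw]⟩

variable [IsNoetherianRing O]

/-- **At a crossing point (critical primes `(x)`, `(y)`), every prime element dividing all of
`J(O, f, E(f))` is associated to `x` or to `y`.** If `π ∤ x` and `π ∤ y`, then from `π ∣ xy·D f`
for all `D` we get `J(O, f) ⊆ (π)`, so `(π)` is a critical prime, i.e. `(π) = (x)` or `(y)`.
[cite: Giraud1983, 2.5] -/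
theorem associated_or_associated_of_prime_of_logDerivJacobianIdeal_le_span {x y : O} (hx : Prime x)
    (hy : Prime y) (f : O)
    (hcrit : ∀ P : Ideal O, P ∈ derivCriticalPrimes O f ↔ (P = Ideal.span {x} ∨ P = Ideal.span {y}))
    {π : O} (hπ : Prime π) (hle : logDerivJacobianIdeal O f ≤ Ideal.span {π}) :
    Associated π x ∨ Associated π y := by
  by_cases hπx : π ∣ x
  · exact Or.inl (associated_of_prime_dvd_prime hπ hx hπx)
  by_cases hπy : π ∣ y
  · exact Or.inr (associated_of_prime_dvd_prime hπ hy hπy)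
  -- `π ∣ D f` for every derivation
  have hdvd : ∀ D : Derivation ℤ O O, π ∣ D f := fun D => by
    have h1 : π ∣ x * y * D f := Ideal.mem_span_singleton.mp
      (hle (mul_derivation_apply_mem_logDerivJacobianIdeal f
        (mul_mem_of_mem_derivCriticalPrimes₂ f hcrit) D))
    rcases hπ.dvd_or_dvd h1 with h2 | h2
    · exact ((hπ.dvd_or_dvd h2).elim hπx hπy).elim
    · exact h2
  have hJ : derivJacobianIdeal O f ≤ Ideal.span {π} := by
    unfold derivJacobianIdeal
    rw [Ideal.span_le]
    rintro _ ⟨D, rfl⟩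
    exact Ideal.mem_span_singleton.mpr (hdvd D)
  have hP : Ideal.span {π} ∈ derivCriticalPrimes O f :=
    ⟨(Ideal.span_singleton_prime hπ.ne_zero).mpr hπ, height_span_singleton_eq_one_of_prime hπ, hJ⟩
  rcases (hcrit _).mp hP with h | h
  · exact Or.inl (Ideal.span_singleton_eq_span_singleton.mp h)
  · exact Or.inr (Ideal.span_singleton_eq_span_singleton.mp h)

variable [UniqueFactorizationMonoid O]

/-- **`B(J(O, f, E(f))) = (xᵃyᵇ)` at a crossing point** (`J ≠ 0`), with `J = (xᵃyᵇ)·D(J)`.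
[cite: Giraud1983, 2.1 and 2.5] -/
theorem exists_principalHullIdeal_logDerivJacobianIdeal_eq_span_pow_mul_pow {x y : O} (hx : Prime x)
    (hy : Prime y) (f : O)
    (hcrit : ∀ P : Ideal O, P ∈ derivCriticalPrimes O f ↔ (P = Ideal.span {x} ∨ P = Ideal.span {y}))
    (hJ : logDerivJacobianIdeal O f ≠ ⊥) :
    ∃ a b : ℕ, principalHullIdeal (logDerivJacobianIdeal O f) = Ideal.span {x ^ a * y ^ b} ∧
      logDerivJacobianIdeal O f =
        Ideal.span {x ^ a * y ^ b} * coprincipalPart (logDerivJacobianIdeal O f) := by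
  set J := logDerivJacobianIdeal O f with hJdef
  obtain ⟨g, hgJ, -, hB⟩ := exists_principalHullIdeal_eq_span (I := J) (IsNoetherian.noetherian J)
  have hg0 : g ≠ 0 := by
    intro h0
    apply hJ
    rw [← le_bot_iff]
    intro c hc
    have := hgJ c hc
    rw [h0, zero_dvd_iff] at this
    exact this
  obtain ⟨a, b, hga⟩ := PfaffLine.exists_associated_pow_mul_pow_of_forall_prime_dvd x y hg0
    (fun π hπ hπg => associated_or_associated_of_prime_of_logDerivJacobianIdeal_le_span hx hy f hcrit
      hπ (fun c hc => Ideal.mem_span_singleton.mpr (hπg.trans (hgJ c hc))))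
  have hB' : principalHullIdeal J = Ideal.span {x ^ a * y ^ b} := by
    rw [hB]; exact Ideal.span_singleton_eq_span_singleton.mpr hga
  exact ⟨a, b, hB', eq_span_singleton_mul_coprincipalPart hB'⟩

/-! ## § 2 `c = 0`: the log-Jacobian ideal is a principal monomial ideal -/

/-- **`c = 0` at a non-crossing point ⇒ `J(O, f, E(f)) = (xᵃ)`** (`D(J) = ⊤`, `J = B(J)`).
[cite: Giraud1983, 2.2 and 2.5] -/
theorem logDerivJacobianIdeal_eq_span_pow_of_giraudColength_eq_zero {x : O} (hx : Prime x) (f : O)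
    (hcrit : ∀ P : Ideal O, P ∈ derivCriticalPrimes O f ↔ P = Ideal.span {x})
    (hJ : logDerivJacobianIdeal O f ≠ ⊥) (hc : giraudColength O f = 0) :
    ∃ a : ℕ, logDerivJacobianIdeal O f = Ideal.span {x ^ a} := by
  obtain ⟨a, -, -, hJeq⟩ := exists_principalHullIdeal_logDerivJacobianIdeal_eq_span_pow hx f hcrit hJ
  refine ⟨a, ?_⟩
  rw [hJeq, (giraudColength_eq_zero_iff f).mp hc, Ideal.mul_top]

/-- **`c = 0` at a crossing point ⇒ `J(O, f, E(f)) = (xᵃyᵇ)`.** [cite: Giraud1983, 2.2 and 2.5] -/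
theorem logDerivJacobianIdeal_eq_span_pow_mul_pow_of_giraudColength_eq_zero {x y : O} (hx : Prime x)
    (hy : Prime y) (f : O)
    (hcrit : ∀ P : Ideal O, P ∈ derivCriticalPrimes O f ↔ (P = Ideal.span {x} ∨ P = Ideal.span {y}))
    (hJ : logDerivJacobianIdeal O f ≠ ⊥) (hc : giraudColength O f = 0) :
    ∃ a b : ℕ, logDerivJacobianIdeal O f = Ideal.span {x ^ a * y ^ b} := by
  obtain ⟨a, b, -, hJeq⟩ :=
    exists_principalHullIdeal_logDerivJacobianIdeal_eq_span_pow_mul_pow hx hy f hcrit hJ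
  refine ⟨a, b, ?_⟩
  rw [hJeq, (giraudColength_eq_zero_iff f).mp hc, Ideal.mul_top]

end Crossing

/-! ## § 3 The log-Jacobian ideal in span form when the critical primes are the branches -/

/-- `J(O, f, E(f)) = ({D f : x ∣ D x})` when `(x)` is the only critical prime. [cite: Giraud1983,
1.1 (3)] -/
theorem logDerivJacobianIdeal_eq_span_logDerivation₁ {O : Type u} [CommRing O] {x : O} (f : O)
    (hcrit : ∀ P : Ideal O, P ∈ derivCriticalPrimes O f ↔ P = Ideal.span {x}) :
    logDerivJacobianIdeal O f =
      Ideal.span {v : O | ∃ D : Derivation ℤ O O, x ∣ D x ∧ D f = v} := by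
  unfold logDerivJacobianIdeal
  congr 1
  ext v
  simp only [Set.mem_setOf_eq]
  constructor
  · rintro ⟨D, hD, rfl⟩
    exact ⟨D, (forall_mem_span_singleton_iff_dvd D x).mp (hD _ ((hcrit _).mpr rfl)), rfl⟩
  · rintro ⟨D, hD, rfl⟩
    refine ⟨D, fun P hP => ?_, rfl⟩
    rw [(hcrit P).mp hP]
    exact (forall_mem_span_singleton_iff_dvd D x).mpr hD

/-- `J(O, f, E(f)) = ({D f : x ∣ D x, y ∣ D y})` when the critical primes are `(x)` and `(y)`.
[cite: Giraud1983, 1.1 (3)] -/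
theorem logDerivJacobianIdeal_eq_span_logDerivation₂ {O : Type u} [CommRing O] {x y : O} (f : O)
    (hcrit : ∀ P : Ideal O, P ∈ derivCriticalPrimes O f ↔ (P = Ideal.span {x} ∨ P = Ideal.span {y})) :
    logDerivJacobianIdeal O f =
      Ideal.span {v : O | ∃ D : Derivation ℤ O O, x ∣ D x ∧ y ∣ D y ∧ D f = v} := by
  unfold logDerivJacobianIdeal
  congr 1
  ext v
  simp only [Set.mem_setOf_eq]
  constructor
  · rintro ⟨D, hD, rfl⟩
    exact ⟨D, (forall_mem_span_singleton_iff_dvd D x).mp (hD _ ((hcrit _).mpr (Or.inl rfl))),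
      (forall_mem_span_singleton_iff_dvd D y).mp (hD _ ((hcrit _).mpr (Or.inr rfl))), rfl⟩
  · rintro ⟨D, hDx, hDy, rfl⟩
    refine ⟨D, fun P hP => ?_, rfl⟩
    rcases (hcrit P).mp hP with h | h
    · rw [h]; exact (forall_mem_span_singleton_iff_dvd D x).mpr hDx
    · rw [h]; exact (forall_mem_span_singleton_iff_dvd D y).mpr hDy

/-! ## § 4 The read-off at a critical point, ring level (B7 parts (2)–(6)) -/

/-- **B7, crossing point, ring level.** `O` a two-dimensional regular local `𝔽_p`-algebra formally
smooth over `𝔽_p`; `x, y` regular parameters belonging to a `p`-basis `Γ` of `O` over `O^p`; the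
critical primes of `f` (height-one primes containing `J(O, f)`) are exactly `(x)` and `(y)`; `f` is
not a `p`-th power; `c(O, f) = 0`. Then `f` is in Giraud's normal form at the point.
[cite: Giraud1983, Prop. 1.5 (i) ⇒ (ii) and 2.2] -/
theorem giraud15NormalFormAt_of_criticalPrimes_eq₂ (p : ℕ) [Fact p.Prime] {O : Type u}
    [CommRing O] [IsRegularLocalRing O] [Algebra (ZMod p) O] [Algebra.FormallySmooth (ZMod p) O]
    [CharP O p] (hdim : ringKrullDim O = 2) {Γ : Set O}
    (hΓ : IsPBasisOver p (frobenius O p).range Γ) {x y f : O} (hx : x ∈ Γ) (hy : y ∈ Γ)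
    (hxy : Ideal.span {x, y} = maximalIdeal O)
    (hcrit : ∀ P : Ideal O, P ∈ derivCriticalPrimes O f ↔ (P = Ideal.span {x} ∨ P = Ideal.span {y}))
    (hf : f ∉ (frobenius O p).range) (hc : giraudColength O f = 0) :
    Giraud15NormalFormAt p f := by
  classical
  haveI : IsDomain O := isDomain_of_isRegularLocalRing O
  haveI : UniqueFactorizationMonoid O :=
    uniqueFactorizationMonoid_of_isRegularLocalRing O inferInstance
  obtain ⟨hPx, -⟩ := isPrime_span_singleton_and_not_mem_of_rsop₂ hdim hxy
  have hyx : Ideal.span {y, x} = maximalIdeal O := by rw [Set.pair_comm]; exact hxy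
  obtain ⟨hPy, -⟩ := isPrime_span_singleton_and_not_mem_of_rsop₂ hdim hyx
  obtain ⟨δ₀, δ₁, h₀x, -, -, h₁y⟩ := exists_dual_pair p hdim hxy
  have hx0 : x ≠ 0 := fun h => by simp [h] at h₀x
  have hy0 : y ≠ 0 := fun h => by simp [h] at h₁y
  have hxp : Prime x := (Ideal.span_singleton_prime hx0).mp hPx
  have hyp : Prime y := (Ideal.span_singleton_prime hy0).mp hPy
  obtain ⟨δ, hδ₁, hδ₀⟩ := IsPBasisOver.exists_dual_derivations hΓ
  have hJ0 : logDerivJacobianIdeal O f ≠ ⊥ :=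
    logDerivJacobianIdeal_ne_bot δ hδ₁ hδ₀ hΓ hf (mul_ne_zero hx0 hy0)
      (mul_mem_of_mem_derivCriticalPrimes₂ f hcrit)
  obtain ⟨a, b, hJ⟩ :=
    logDerivJacobianIdeal_eq_span_pow_mul_pow_of_giraudColength_eq_zero hxp hyp f hcrit hJ0 hc
  have hJ' : Ideal.span {v : O | ∃ D : Derivation ℤ O O, x ∣ D x ∧ y ∣ D y ∧ D f = v} =
      Ideal.span {x ^ a * y ^ b} := by
    rw [← logDerivJacobianIdeal_eq_span_logDerivation₂ f hcrit, hJ]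
  exact giraud15NormalFormAt_crossing_of_critical p hdim hΓ hx hy hxy hJ'
    ((hcrit _).mpr (Or.inl rfl)).2.2 ((hcrit _).mpr (Or.inr rfl)).2.2

/-- **B7, non-crossing point, ring level.** Same setting; the only critical prime of `f` is `(x)`;
`f ∉ O^p`; `c(O, f) = 0` ⇒ Giraud's normal form. [cite: Giraud1983, Prop. 1.5 (i) ⇒ (ii) and 2.2] -/
theorem giraud15NormalFormAt_of_criticalPrimes_eq₁ (p : ℕ) [Fact p.Prime] {O : Type u}
    [CommRing O] [IsRegularLocalRing O] [Algebra (ZMod p) O] [Algebra.FormallySmooth (ZMod p) O]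
    [CharP O p] (hdim : ringKrullDim O = 2) {Γ : Set O}
    (hΓ : IsPBasisOver p (frobenius O p).range Γ) {x y f : O} (hx : x ∈ Γ)
    (hxy : Ideal.span {x, y} = maximalIdeal O)
    (hcrit : ∀ P : Ideal O, P ∈ derivCriticalPrimes O f ↔ P = Ideal.span {x})
    (hf : f ∉ (frobenius O p).range) (hc : giraudColength O f = 0) :
    Giraud15NormalFormAt p f := by
  classical
  haveI : IsDomain O := isDomain_of_isRegularLocalRing O
  haveI : UniqueFactorizationMonoid O :=
    uniqueFactorizationMonoid_of_isRegularLocalRing O inferInstance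
  obtain ⟨hPx, -⟩ := isPrime_span_singleton_and_not_mem_of_rsop₂ hdim hxy
  obtain ⟨δ₀, δ₁, h₀x, -, -, -⟩ := exists_dual_pair p hdim hxy
  have hx0 : x ≠ 0 := fun h => by simp [h] at h₀x
  have hxp : Prime x := (Ideal.span_singleton_prime hx0).mp hPx
  obtain ⟨δ, hδ₁, hδ₀⟩ := IsPBasisOver.exists_dual_derivations hΓ
  have hJ0 : logDerivJacobianIdeal O f ≠ ⊥ :=
    logDerivJacobianIdeal_ne_bot δ hδ₁ hδ₀ hΓ hf hx0 (fun P hP => by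
      rw [(hcrit P).mp hP]; exact Ideal.mem_span_singleton_self x)
  obtain ⟨a, hJ⟩ := logDerivJacobianIdeal_eq_span_pow_of_giraudColength_eq_zero hxp f hcrit hJ0 hc
  have hJ' : Ideal.span {v : O | ∃ D : Derivation ℤ O O, x ∣ D x ∧ D f = v} =
      Ideal.span {x ^ a} := by
    rw [← logDerivJacobianIdeal_eq_span_logDerivation₁ f hcrit, hJ]
  exact giraud15NormalFormAt_noncrossing_of_critical p hdim hΓ hx hxy hJ' ((hcrit _).mpr rfl).2.2

end Summit.ResolutionOfSingularities.ResolutionOfSingularities.Theorems.RadicialJung.CleanModels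

end
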